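import Mathlib.NumberTheory.ModularForms.QExpansion
import Mathlib.NumberTheory.ModularForms.CongruenceSubgroups
import Mathlib.NumberTheory.Padics.PadicIntegers
import Mathlib.NumberTheory.Padics.PadicVal.Basic
import Mathlib.RingTheory.IntegralClosure.IntegrallyClosed
import Mathlib.Algebra.GCDMonoid.IntegrallyClosed
import Mathlib.Algebra.CharP.Basic
import Literature.NumberTheory.ModularForms.KatzQExpansionPrincipleCusps
import HarnessLib

set_option autoImplicit false

/-!
# Crux `PrintCFram.BottomClassIndexLawFiveLe` (stmt-BirchSwinnertonDyer-20372), line `eisenstein-resource-bdp-line` (registry v24):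
# CUSP-GLUE GENERICS (γ) — Katz's q-expansion principle READ AT THE CUSP `0`: «coefficients at `∞` in `d·ℤ̄[1/N]` ⟹ the constant
# term of `f ∣_k γ` lies in `d·ℤ̄[1/N]`», the integrality transfer `ℚ ∩ p²·ℤ̄[1/N] ⟹ v_p ≥ 2`, and the kernel of `ι : ℤ_p → 𝔽`
# (cell `bsd-print-cfram`, width seat `bsd-line-cfram-p1-w8` g8; THEOREMS ONLY, `--supports` 20372; BSD is not proved by any of this)

HONEST FRAMING. Nothing here is a statement about elliptic curves or BSD; no registered stub is closed. This file supplies the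
generic plumbing between the typed named fact `Literature.NumberTheory.ModularForms.Katz1973_qExpansionPrinciple_allCusps` (NF-Q,
p691071: stated for `ModularForm (Gamma N) k` and the q-expansion in the parameter `e^{2πiz/N}`) and the cusp conjunct (iii)
«`G = 0 ⟹ ∀ x : ℤ_p, ↑x = C → ι x = 0`» of registry v24's `stub_cuspCutForm` (= `hcut` of `CuspSeed.cuspSeed_six_of_cutForm`, p688228),
whose vehicle is a form on `Γ₁(L)` with a `1`-periodic q-expansion:
* §1 `Γ(N) ≤ Γ₁(L)` for `L ∣ N` and the restriction `ModularForm (Gamma1 L) k → ModularForm (Gamma N) k` (same function);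
* §2 the q-expansion of a `1`-periodic form in the parameter `e^{2πiz/N}`: `coeff n (qExpansion N f) = [N ∣ n] · coeff (n/N) (qExpansion 1 f)`;
* §3 `f ∣_k γ` (`γ ∈ SL₂(ℤ)`) is again a modular form on `Γ(N)` (normality), so `coeff 0 (qExpansion N (f ∣_k γ)) = valueAtInfty (f ∣_k γ)`;
* §4 THE APPLIED PRINCIPLE: NF-Q ⟹ for `f : ModularForm (Gamma1 L) k`, `L ∣ N`, `3 ≤ N`, if every coefficient of `qExpansion 1 f` lies in
  `d·ℤ̄[1/N]` then `valueAtInfty (f ∣_k γ) ∈ d·ℤ̄[1/N]` for every `γ ∈ SL₂(ℤ)` (in particular at the cusp `0`, `γ = S`);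
* §5 INTEGRALITY TRANSFER: `x : ℚ`, `(u·x² : ℂ) = (p·y)²` with `N^j·y` integral over `ℤ`, `p ∤ N`, `u ∈ ℚ^×` a `p`-unit ⟹
  `x = 0 ∨ 1 ≤ v_p(x)` (`ℤ` is integrally closed: `ℚ ∩ ℤ̄ = ℤ`);
* §6 the last arrow of (iii): for `ι : ℤ_p →+* 𝔽`, `𝔽` a field of characteristic `p`, `‖x‖ < 1 ⟹ ι x = 0`, and the packaged
  «`v_p(C) ≥ 1 ⟹ ∀ x, ↑x = ↑C → ι x = 0`».
The analytic evaluation of `valueAtInfty (F' ∣ S)` for the cusp vehicle (Lemma A p691154, the Jacobi inversion of the theta factor, (E1)–(E4)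
of seat w5 g6, (D) of seat w3 g13) and the integrality of the cut Cohen numbers away from `2` (seat w7 g6) are NOT here. beyond-print theorem: NO.

References: [Katz1973] §1.6 Cor. 1.6.2, §1.2, §1.7; [DiamondShurman2005] §1.2 (weight-`k` operators, `Γ(N) ⊴ SL₂(ℤ)`), §1.1
(q-expansions); crux notes `Lines/eisenstein-resource-bdp-line-w5g5-cusp-seed.md` §§14–15 (plan (A)–(F) and the glue).
-/

-- summit-side namespace `Summit.BirchSwinnertonDyer.BirchSwinnertonDyer.…` (single-conjunct summit, D-0017 layout)
set_option linter.dupNamespace false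

noncomputable section

namespace Summit.BirchSwinnertonDyer.BirchSwinnertonDyer.Theorems.PrintCFram.CuspGlue

open UpperHalfPlane Filter Function Complex CongruenceSubgroup PowerSeries
open scoped MatrixGroups ModularForm Topology Manifold Real

/-! ## §1 `Γ(N) ≤ Γ₁(L)` for `L ∣ N`; restriction of a `Γ₁(L)`-form to `Γ(N)` -/

/-- `Γ(N) ≤ Γ₁(L)` whenever `L ∣ N` (reduce the congruences mod `N` to congruences mod `L`). [cite: DiamondShurman2005, §1.2] -/
theorem gamma_le_gamma1_of_dvd {L N : ℕ} (hLN : L ∣ N) : Gamma N ≤ Gamma1 L := by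
  intro γ hγ
  rw [Gamma_mem] at hγ
  obtain ⟨h00, -, h10, h11⟩ := hγ
  have key : ∀ {a b : ℤ}, (a : ZMod N) = (b : ZMod N) → (a : ZMod L) = (b : ZMod L) := fun {a b} h => by
    rw [ZMod.intCast_eq_intCast_iff_dvd_sub] at h ⊢
    exact (Int.natCast_dvd_natCast.mpr hLN).trans h
  rw [Gamma1_mem]
  refine ⟨?_, ?_, ?_⟩
  · have := key (a := (γ : Matrix (Fin 2) (Fin 2) ℤ) 0 0) (b := 1) (by simpa using h00)
    simpa using this
  · have := key (a := (γ : Matrix (Fin 2) (Fin 2) ℤ) 1 1) (b := 1) (by simpa using h11)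
    simpa using this
  · have := key (a := (γ : Matrix (Fin 2) (Fin 2) ℤ) 1 0) (b := 0) (by simpa using h10)
    simpa using this

/-- **Restriction to `Γ(N)`.** A modular form on `Γ₁(L)` is a modular form on `Γ(N)` for every `N` with `L ∣ N`, with the same
underlying function (the cusps of both arithmetic groups are all of `ℙ¹(ℚ)`). [cite: DiamondShurman2005, §1.2] -/
theorem exists_modularForm_gamma_coe_eq_of_gamma1 {L N : ℕ} {k : ℤ} (f : ModularForm (Gamma1 L) k) (hLN : L ∣ N) :
    ∃ g : ModularForm (Gamma N) k, ⇑g = ⇑f :=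
  ⟨{ toFun := f
     slash_action_eq' := fun A hA => by
       obtain ⟨γ, hγ, rfl⟩ := hA
       exact SlashInvariantFormClass.slash_action_eq f _ ⟨γ, gamma_le_gamma1_of_dvd hLN hγ, rfl⟩
     holo' := f.holo'
     bdd_at_cusps' := fun hc => f.bdd_at_cusps' (hc.mono fun A hA => by
       obtain ⟨γ, hγ, rfl⟩ := hA
       exact ⟨γ, gamma_le_gamma1_of_dvd hLN hγ, rfl⟩) }, rfl⟩

/-! ## §2 The q-expansion of a `1`-periodic form in the parameter `e^{2πiz/N}` -/

/-- `𝕢_1(τ) = 𝕢_N(τ)^N` (`e^{2πiτ} = (e^{2πiτ/N})^N`). [cite: DiamondShurman2005, §1.1] -/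
theorem qParam_one_eq_qParam_pow {N : ℕ} (hN : 0 < N) (z : ℂ) :
    Periodic.qParam 1 z = Periodic.qParam N z ^ N := by
  rw [Periodic.qParam, Periodic.qParam, ← Complex.exp_nat_mul]
  congr 1
  have hN0 : (N : ℂ) ≠ 0 := by exact_mod_cast hN.ne'
  push_cast
  field_simp

/-- Uniqueness of q-expansion coefficients for a bare function `f : ℍ → ℂ` (Mathlib's `qExpansion_coeff_unique` is stated for
bundled `FunLike` types): if `cuspFunction h f` is analytic at `0` and `f τ = Σ c(m) 𝕢_h(τ)^m` for all `τ`, then `c` is the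
coefficient sequence of `qExpansion h f`. [cite: DiamondShurman2005, §1.1] -/
theorem qExpansion_coeff_unique_of_hasSum {f : ℍ → ℂ} {h : ℝ} {c : ℕ → ℂ} (hh : 0 < h)
    (hfanalytic : AnalyticAt ℂ (cuspFunction h f) 0)
    (hf : ∀ τ : ℍ, HasSum (fun m ↦ c m • Periodic.qParam h τ ^ m) (f τ)) (m : ℕ) :
    c m = (qExpansion h f).coeff m := by
  have h1 := (hasFPowerSeriesOnBall_cuspFunction hh hfanalytic hf).hasFPowerSeriesAt
  have h2 : HasFPowerSeriesAt (cuspFunction h f)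
      (FormalMultilinearSeries.ofScalars ℂ fun n ↦ (qExpansion h f).coeff n) 0 := by
    simpa [qExpansion_coeff, div_eq_mul_inv, mul_comm] using hfanalytic.hasFPowerSeriesAt
  have h3 := congr_arg (FormalMultilinearSeries.coeff · m) (h1.eq_formalMultilinearSeries h2)
  simpa [FormalMultilinearSeries.coeff_ofScalars] using h3

/-- **The q-expansion in the parameter `e^{2πiz/N}` of a `1`-periodic function.** If `f : ℍ → ℂ` is `1`-periodic, holomorphic and
bounded at `i∞`, then for `N ≥ 1` its q-expansion in the parameter `𝕢_N = e^{2πiz/N}` is the `N`-fold dilation of its q-expansion in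
`𝕢_1 = e^{2πiz}`: `coeff n (qExpansion N f) = coeff (n/N) (qExpansion 1 f)` if `N ∣ n`, and `0` otherwise.
[cite: DiamondShurman2005, §1.1] -/
theorem qExpansion_natCast_coeff_eq_ite {f : ℍ → ℂ} {N : ℕ} (hN : 0 < N) (hper : Periodic (f ∘ ofComplex) 1)
    (hhol : MDifferentiable 𝓘(ℂ) 𝓘(ℂ) f) (hbdd : IsBoundedAtImInfty f) (n : ℕ) :
    (qExpansion (N : ℝ) f).coeff n = if N ∣ n then (qExpansion 1 f).coeff (n / N) else 0 := by
  have hN' : (0 : ℝ) < N := by exact_mod_cast hN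
  have hperN : Periodic (f ∘ ofComplex) (N : ℝ) := by
    have := hper.nat_mul N
    simpa using this
  -- the candidate coefficient sequence in the parameter `𝕢_N` is `m ↦ [N ∣ m] · a(m/N)`
  obtain ⟨c, hc⟩ : ∃ c : ℕ → ℂ, c = fun m => if N ∣ m then (qExpansion 1 f).coeff (m / N) else 0 := ⟨_, rfl⟩
  have hsum : ∀ τ : ℍ, HasSum (fun m ↦ c m • Periodic.qParam N τ ^ m) (f τ) := by
    intro τ
    have hinj : Injective (fun m : ℕ => N * m) := fun a b hab => Nat.eq_of_mul_eq_mul_left hN hab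
    have hcm : ∀ m : ℕ, c (N * m) = (qExpansion 1 f).coeff m := fun m => by
      rw [hc]
      show (if N ∣ N * m then (qExpansion 1 f).coeff (N * m / N) else (0 : ℂ)) = _
      rw [if_pos (dvd_mul_right N m), Nat.mul_div_cancel_left m hN]
    have heq : ((fun m ↦ c m • Periodic.qParam N τ ^ m) ∘ fun m : ℕ => N * m) =
        fun m ↦ (qExpansion 1 f).coeff m • Periodic.qParam 1 τ ^ m := by
      funext m
      rw [comp_apply, hcm, pow_mul, ← qParam_one_eq_qParam_pow hN]
    have h1 : HasSum ((fun m ↦ c m • Periodic.qParam N τ ^ m) ∘ fun m : ℕ => N * m) (f τ) := by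
      rw [heq]
      exact hasSum_qExpansion one_pos hper hhol hbdd τ
    refine (hinj.hasSum_iff ?_).mp h1
    intro x hx
    have hx' : ¬ N ∣ x := by
      rintro ⟨m, rfl⟩
      exact hx ⟨m, rfl⟩
    have hcx : c x = 0 := by
      rw [hc]
      show (if N ∣ x then (qExpansion 1 f).coeff (x / N) else (0 : ℂ)) = 0
      rw [if_neg hx']
    show c x • Periodic.qParam N τ ^ x = 0
    rw [hcx, zero_smul]
  have han : AnalyticAt ℂ (cuspFunction (N : ℝ) f) 0 := analyticAt_cuspFunction_zero hN' hperN hhol hbdd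
  have key := qExpansion_coeff_unique_of_hasSum hN' han hsum n
  rw [← key, hc]

/-! ## §3 `f ∣_k γ` is a form on `Γ(N)` for `γ ∈ SL₂(ℤ)`; its constant term is its value at `i∞` -/

/-- **`f ∣_k γ` is again a modular form on `Γ(N)`** for `f` a modular form on `Γ(N)` and `γ ∈ SL₂(ℤ)` (`Γ(N)` is normal in `SL₂(ℤ)`;
the cusps are permuted by `γ`). [cite: DiamondShurman2005, §1.2] -/
theorem exists_modularForm_gamma_coe_eq_slash {N : ℕ} [NeZero N] {k : ℤ} (f : ModularForm (Gamma N) k) (γ : SL(2, ℤ)) :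
    ∃ g : ModularForm (Gamma N) k, ⇑g = ⇑f ∣[k] γ := by
  refine ⟨{ toFun := ⇑f ∣[k] γ
            slash_action_eq' := ?_
            holo' := (f.holo').slash k _
            bdd_at_cusps' := ?_ }, rfl⟩
  · intro A hA
    obtain ⟨δ, hδ, rfl⟩ := hA
    have hδ' : γ * δ * γ⁻¹ ∈ Gamma N := (Gamma_normal N).conj_mem δ hδ γ
    have hinv : ⇑f ∣[k] (γ * δ * γ⁻¹) = ⇑f :=
      SlashInvariantFormClass.slash_action_eq f _ ⟨γ * δ * γ⁻¹, hδ', rfl⟩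
    have e1 : (⇑f ∣[k] γ) ∣[k] δ = ⇑f ∣[k] (γ * δ) := (SlashAction.slash_mul k γ δ ⇑f).symm
    have e2 : ⇑f ∣[k] (γ * δ) = (⇑f ∣[k] (γ * δ * γ⁻¹)) ∣[k] γ := by
      rw [← SlashAction.slash_mul, inv_mul_cancel_right]
    show (⇑f ∣[k] γ) ∣[k] δ = ⇑f ∣[k] γ
    rw [e1, e2, hinv]
  · intro c hc
    show c.IsBoundedAt (⇑f ∣[k] (γ : GL (Fin 2) ℝ)) k
    rw [← OnePoint.IsBoundedAt.smul_iff]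
    apply ModularFormClass.bdd_at_cusps f
    rw [Subgroup.IsArithmetic.isCusp_iff_isCusp_SL2Z, isCusp_SL2Z_iff'] at hc ⊢
    obtain ⟨g₀, rfl⟩ := hc
    exact ⟨γ * g₀, by rw [map_mul, mul_smul]; rfl⟩

/-- `f ∣_k γ` is `N`-periodic, holomorphic and bounded at `i∞` (for `f` on `Γ(N)`, `N ≥ 1`, `γ ∈ SL₂(ℤ)`), hence its q-expansion in
`e^{2πiz/N}` has constant term `valueAtInfty (f ∣_k γ)` — the value of `f` at the cusp `γ·∞`. [cite: DiamondShurman2005, §1.2] -/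
theorem qExpansion_slash_coeff_zero_eq_valueAtInfty {N : ℕ} [NeZero N] {k : ℤ} (f : ModularForm (Gamma N) k) (γ : SL(2, ℤ)) :
    (qExpansion (N : ℝ) (⇑f ∣[k] γ)).coeff 0 = valueAtInfty (⇑f ∣[k] γ) := by
  obtain ⟨g, hg⟩ := exists_modularForm_gamma_coe_eq_slash f γ
  have hN : (0 : ℝ) < N := by exact_mod_cast Nat.pos_of_ne_zero (NeZero.ne N)
  have hΓ : (N : ℝ) ∈ (Gamma N : Subgroup (GL (Fin 2) ℝ)).strictPeriods := by
    rw [strictPeriods_Gamma]; exact AddSubgroup.mem_zmultiples _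
  rw [← hg]
  exact UpperHalfPlane.qExpansion_coeff_zero hN (ModularFormClass.analyticAt_cuspFunction_zero g hN hΓ)
    (SlashInvariantFormClass.periodic_comp_ofComplex g hΓ)

/-! ## §4 The applied principle: coefficients at `∞` in `d·ℤ̄[1/N]` ⟹ the value at every cusp in `d·ℤ̄[1/N]` -/

/-- **Katz's q-expansion principle read at a cusp (from the named fact NF-Q).** Let `f` be a modular form of weight `k` on `Γ₁(L)`,
`L ∣ N`, `3 ≤ N`, `d ∈ ℕ`. If every coefficient of its q-expansion at `∞` (parameter `e^{2πiz}`) is `d·y` with `y ∈ ℤ̄[1/N]`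
(`∃ j, N^j·y` integral over `ℤ`), then for every `γ ∈ SL₂(ℤ)` the value of `f ∣_k γ` at `i∞` — the constant term of `f` at the cusp
`γ·∞`; for `γ = S` the cusp `0` — is `d·y` with `y ∈ ℤ̄[1/N]`. CONDITIONAL on `Katz1973_qExpansionPrinciple_allCusps` (hypothesis).
[cite: Katz1973, §1.6 Cor. 1.6.2, §1.2, §1.7] -/
theorem exists_isIntegral_valueAtInfty_slash_of_qExpansion_one
    (hQ : Literature.NumberTheory.ModularForms.Katz1973_qExpansionPrinciple_allCusps)
    {L N : ℕ} (hLN : L ∣ N) (hN : 3 ≤ N) {k : ℤ} (f : ModularForm (Gamma1 L) k) (d : ℕ)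
    (hcoef : ∀ n : ℕ, ∃ y : ℂ, (∃ j : ℕ, IsIntegral ℤ ((N : ℂ) ^ j * y)) ∧ (qExpansion 1 ⇑f).coeff n = (d : ℂ) * y)
    (γ : SL(2, ℤ)) :
    ∃ y : ℂ, (∃ j : ℕ, IsIntegral ℤ ((N : ℂ) ^ j * y)) ∧ valueAtInfty (⇑f ∣[k] γ) = (d : ℂ) * y := by
  have hN0 : 0 < N := by omega
  haveI : NeZero N := ⟨hN0.ne'⟩
  haveI : NeZero L := ⟨by rintro rfl; rw [zero_dvd_iff] at hLN; omega⟩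
  obtain ⟨g, hg⟩ := exists_modularForm_gamma_coe_eq_of_gamma1 f hLN
  have h1 : (1 : ℝ) ∈ (Gamma1 L : Subgroup (GL (Fin 2) ℝ)).strictPeriods := by
    rw [strictPeriods_Gamma1]; exact AddSubgroup.mem_zmultiples _
  have hper : Periodic (⇑f ∘ ofComplex) 1 := SlashInvariantFormClass.periodic_comp_ofComplex f h1
  have hbdd : IsBoundedAtImInfty ⇑f := ModularFormClass.bdd_at_infty f
  -- the hypothesis of NF-Q for `g` (q-expansion in the parameter `e^{2πiz/N}`)
  have hcoefN : ∀ n : ℕ, ∃ y : ℂ, (∃ j : ℕ, IsIntegral ℤ ((N : ℂ) ^ j * y)) ∧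
      (qExpansion N ⇑g).coeff n = (d : ℂ) * y := by
    intro n
    rw [hg, qExpansion_natCast_coeff_eq_ite hN0 hper f.holo' hbdd n]
    by_cases hn : N ∣ n
    · rw [if_pos hn]; exact hcoef (n / N)
    · rw [if_neg hn]; exact ⟨0, ⟨0, by simpa using isIntegral_zero⟩, by simp⟩
  obtain ⟨y, hy, hcoeff⟩ := hQ N hN k g d hcoefN γ 0
  refine ⟨y, hy, ?_⟩
  rw [← hg, ← qExpansion_slash_coeff_zero_eq_valueAtInfty g γ, hcoeff]

/-! ## §5 Integrality transfer: `ℚ ∩ p^e·ℤ̄[1/N]` -/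

/-- **Integrality transfer.** Let `p` be a prime, `p ∤ N`, and `x : ℚ` with `(x : ℂ) = p^e · y` for some `y ∈ ℤ̄[1/N]`
(`N^j · y` integral over `ℤ`). Then `x = 0` or `e ≤ v_p(x)`. [folklore] -/
theorem le_padicValRat_of_eq_pow_mul {p N : ℕ} [hp : Fact p.Prime] (hpN : ¬ p ∣ N) {x : ℚ} {y : ℂ} {e : ℕ}
    (hy : ∃ j : ℕ, IsIntegral ℤ ((N : ℂ) ^ j * y)) (hx : (x : ℂ) = (p : ℂ) ^ e * y) :
    x = 0 ∨ (e : ℤ) ≤ padicValRat p x := by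
  rcases eq_or_ne x 0 with rfl | hx0
  · exact Or.inl rfl
  right
  obtain ⟨j, hj⟩ := hy
  have hp0 : (p : ℚ) ≠ 0 := by exact_mod_cast hp.out.ne_zero
  have hN0 : N ≠ 0 := by rintro rfl; exact hpN (dvd_zero p)
  -- `N^j · x / p^e` is a rational number integral over `ℤ`, hence an integer `z`
  have hrat : (((N : ℚ) ^ j * x / (p : ℚ) ^ e : ℚ) : ℂ) = (N : ℂ) ^ j * y := by
    have hpe : (p : ℂ) ^ e ≠ 0 := pow_ne_zero _ (by exact_mod_cast hp.out.ne_zero)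
    push_cast
    rw [hx]
    field_simp
  -- `ℚ ∩ ℤ̄ = ℤ` (ℤ is integrally closed; cf. `Literature.NumberTheory.LFunctions.WeilEstimate.exists_int_cast_eq_of_isIntegral`,
  -- not imported to keep this file's imports light)
  obtain ⟨z, hz⟩ : ∃ z : ℤ, (z : ℚ) = (N : ℚ) ^ j * x / (p : ℚ) ^ e := by
    have hq : IsIntegral ℤ ((((N : ℚ) ^ j * x / (p : ℚ) ^ e : ℚ)) : ℂ) := by rw [hrat]; exact hj
    have hq' : IsIntegral ℤ ((N : ℚ) ^ j * x / (p : ℚ) ^ e) :=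
      (isIntegral_algHom_iff (algebraMap ℚ ℂ).toIntAlgHom (algebraMap ℚ ℂ).injective).mp hq
    letI : IsIntegrallyClosed ℤ := GCDMonoid.toIsIntegrallyClosed
    obtain ⟨z, hz⟩ := IsIntegrallyClosed.algebraMap_eq_of_integral (R := ℤ) (K := ℚ) hq'
    exact ⟨z, by simpa using hz⟩
  have hz0 : z ≠ 0 := by
    rintro rfl
    rw [Int.cast_zero, eq_comm, div_eq_zero_iff] at hz
    rcases hz with h | h
    · exact hx0 ((mul_eq_zero.mp h).resolve_left (pow_ne_zero _ (by exact_mod_cast hN0)))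
    · exact pow_ne_zero _ hp0 h
  -- `x = p^e · z / N^j`
  have hxeq : x = (p : ℚ) ^ e * z / (N : ℚ) ^ j := by
    rw [hz]
    have hNj : (N : ℚ) ^ j ≠ 0 := pow_ne_zero _ (by exact_mod_cast hN0)
    field_simp
  have hvN : padicValRat p ((N : ℚ) ^ j) = 0 := by
    rw [padicValRat.pow, show ((N : ℚ)) = ((N : ℕ) : ℚ) by rfl, padicValRat.of_nat]
    simp [padicValNat.eq_zero_of_not_dvd hpN]
  have hvp : padicValRat p ((p : ℚ) ^ e) = e := by
    rw [padicValRat.pow, padicValRat.self hp.out.one_lt]; simp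
  have hvz : 0 ≤ padicValRat p (z : ℚ) := by
    rw [padicValRat.of_int]; exact_mod_cast Nat.zero_le _
  rw [hxeq, padicValRat.div (mul_ne_zero (pow_ne_zero _ hp0) (by exact_mod_cast hz0))
    (pow_ne_zero _ (by exact_mod_cast hN0)), padicValRat.mul (pow_ne_zero _ hp0) (by exact_mod_cast hz0), hvp, hvN]
  linarith

/-- **Integrality transfer, squared form** (the shape the cusp glue meets: the square of the cusp constant is rational). Let `p` be a
prime, `p ∤ N`, `u x : ℚ` with `u ≠ 0` a `p`-unit (`v_p(u) = 0`), and `v y : ℂ` with `v = p · y`, `y ∈ ℤ̄[1/N]`, `v² = u · x²`. Then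
`x = 0` or `1 ≤ v_p(x)`. [folklore] -/
theorem one_le_padicValRat_of_sq {p N : ℕ} [hp : Fact p.Prime] (hpN : ¬ p ∣ N) {u x : ℚ} (hu0 : u ≠ 0) (hu : padicValRat p u = 0)
    {v y : ℂ} (hy : ∃ j : ℕ, IsIntegral ℤ ((N : ℂ) ^ j * y)) (hv : v = (p : ℂ) * y) (hsq : v ^ 2 = ((u * x ^ 2 : ℚ) : ℂ)) :
    x = 0 ∨ 1 ≤ padicValRat p x := by
  rcases eq_or_ne x 0 with rfl | hx0
  · exact Or.inl rfl
  right
  have hy2 : ∃ j : ℕ, IsIntegral ℤ ((N : ℂ) ^ j * y ^ 2) := by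
    obtain ⟨j, hj⟩ := hy
    refine ⟨2 * j, ?_⟩
    have : (N : ℂ) ^ (2 * j) * y ^ 2 = ((N : ℂ) ^ j * y) ^ 2 := by ring
    rw [this]; exact hj.pow 2
  have hx2 : ((u * x ^ 2 : ℚ) : ℂ) = (p : ℂ) ^ 2 * y ^ 2 := by rw [← hsq, hv]; ring
  rcases le_padicValRat_of_eq_pow_mul hpN hy2 hx2 with h | h
  · exact absurd h (mul_ne_zero hu0 (pow_ne_zero _ hx0))
  · rw [padicValRat.mul hu0 (pow_ne_zero _ hx0), hu, padicValRat.pow, zero_add] at h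
    push_cast at h
    linarith

/-! ## §6 The last arrow of the cusp conjunct: `ι : ℤ_p → 𝔽` kills the non-units -/

/-- For a ring map `ι : ℤ_p → 𝔽` into a field of characteristic `p`, every `x ∈ ℤ_p` with `‖x‖ < 1` (i.e. `x ∈ pℤ_p`) has `ι x = 0`
(`ι(p) = 0`). [folklore] -/
theorem map_eq_zero_of_norm_lt_one {p : ℕ} [hp : Fact p.Prime] {𝔽 : Type*} [Field 𝔽] [CharP 𝔽 p] (ι : ℤ_[p] →+* 𝔽)
    {x : ℤ_[p]} (hx : ‖x‖ < 1) : ι x = 0 := by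
  have hmem : x ∈ IsLocalRing.maximalIdeal ℤ_[p] := PadicInt.mem_nonunits.mpr hx
  rw [PadicInt.maximalIdeal_eq_span_p, Ideal.mem_span_singleton] at hmem
  obtain ⟨c, rfl⟩ := hmem
  rw [map_mul, map_natCast, CharP.cast_eq_zero 𝔽 p, zero_mul]

/-- A rational number `C` with `C = 0 ∨ 1 ≤ v_p(C)` has `‖C‖_p < 1` in `ℚ_p`. [folklore] -/
theorem padicNorm_lt_one_of_padicValRat {p : ℕ} [hp : Fact p.Prime] {C : ℚ} (hC : C = 0 ∨ 1 ≤ padicValRat p C) :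
    ‖((C : ℚ) : ℚ_[p])‖ < 1 := by
  rcases hC with rfl | hC
  · simp
  · by_cases hC0 : C = 0
    · subst hC0; simp
    rw [Padic.eq_padicNorm, padicNorm.eq_zpow_of_nonzero hC0]
    have hp1 : (1 : ℚ) < p := by exact_mod_cast hp.out.one_lt
    have : ((p : ℚ) ^ (-padicValRat p C) : ℚ) < 1 := by
      apply zpow_lt_one_of_neg₀ hp1; linarith
    exact_mod_cast this

/-- **The last arrow of conjunct (iii).** If the registered cusp constant `C ∈ ℚ` satisfies `C = 0 ∨ 1 ≤ v_p(C)`, then every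
`x ∈ ℤ_p` with `↑x = ↑C` in `ℚ_p` is killed by any ring map `ι : ℤ_p → 𝔽` into a field of characteristic `p` — the conclusion
«`∀ x : ℤ_[p], ↑x = ↑C → ι x = 0`» of `stub_cuspCutForm`'s cusp conjunct. [folklore] -/
theorem forall_map_eq_zero_of_padicValRat {p : ℕ} [hp : Fact p.Prime] {𝔽 : Type*} [Field 𝔽] [CharP 𝔽 p] (ι : ℤ_[p] →+* 𝔽)
    {C : ℚ} (hC : C = 0 ∨ 1 ≤ padicValRat p C) :
    ∀ x : ℤ_[p], (x : ℚ_[p]) = ((C : ℚ) : ℚ_[p]) → ι x = 0 := by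
  intro x hx
  apply map_eq_zero_of_norm_lt_one ι
  rw [PadicInt.norm_def, hx]
  exact padicNorm_lt_one_of_padicValRat hC

/-- **The cusp conjunct from the q-expansion principle, end of the chain.** `p ∤ N` prime, `𝔽` a field of characteristic `p`,
`ι : ℤ_p → 𝔽`; `C u : ℚ`, `u ≠ 0` a `p`-unit; `v ∈ ℂ` (the constant term of the vehicle at the cusp `0`) with `v = p·y`, `y ∈ ℤ̄[1/N]`
(the output of §4 with `d = p`) and `v² = u·C²` (the analytic evaluation). Then `∀ x : ℤ_p, ↑x = ↑C → ι x = 0`. [folklore] -/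
theorem cuspConjunct_of_sq_eq {p N : ℕ} [hp : Fact p.Prime] (hpN : ¬ p ∣ N) {𝔽 : Type*} [Field 𝔽] [CharP 𝔽 p]
    (ι : ℤ_[p] →+* 𝔽) {u C : ℚ} (hu0 : u ≠ 0) (hu : padicValRat p u = 0) {v y : ℂ}
    (hy : ∃ j : ℕ, IsIntegral ℤ ((N : ℂ) ^ j * y)) (hv : v = (p : ℂ) * y) (hsq : v ^ 2 = ((u * C ^ 2 : ℚ) : ℂ)) :
    ∀ x : ℤ_[p], (x : ℚ_[p]) = ((C : ℚ) : ℚ_[p]) → ι x = 0 :=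
  forall_map_eq_zero_of_padicValRat ι (one_le_padicValRat_of_sq hpN hu0 hu hy hv hsq)

end Summit.BirchSwinnertonDyer.BirchSwinnertonDyer.Theorems.PrintCFram.CuspGlue

end
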